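import Mathlib
import HarnessLib
import Literature.MathematicalPhysics.QuantumFieldTheory.ConstructiveQFTWave0
import Summits.Ventures.LatticeQCDFlow.Exactness.LatticeCoordAvg
import Summits.Ventures.LatticeQCDFlow.TrivializingMaps.WilsonLinkLocality
import Summits.Ventures.LatticeQCDFlow.TrivializingMaps.WilsonNonInteractingLinks
import Summits.Ventures.LatticeQCDFlow.Scoring.SU2Cooling

/-!
# LatticeQCDFlow / Scaling — the exact conditional of a link given all others reads only its staples
# (the `s = ∅` autoregressive context of the Wilson weight is at most the plaquette-sharing
# neighbourhood)

HONEST FRAMING: exact (Metropolis-corrected) sampling algorithms for lattice gauge theory;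
figures of merit are autocorrelation/cost numbers at stated couplings and volumes; no
continuum-physics claim.

Venture `LatticeQCDFlow` (cell pub-lqcd), topic `Scaling`, FANOUT row 30 (lean-1, GEN-15) — OUR WORK,
the easy (upper-bound) half of THEORY-2.md §4 row C5 at `s = ∅` for the Wilson weight, companion of
`Scaling/WilsonPlaquetteMateContext` (the matching lower-bound half: a parallel plaquette-mate IS
read) and of `Scaling/AutoregressiveGaugeRedundancy*` (what marginalisation removes).  For EVERY
group `G`, every representation `ρ`, every real `β`, every reference measure `μ` on `G` (Haar or
not), every `d`, `L`:

* (an update is a fibre translation, tree `Scoring.update_eq_mulSingle_mul`); `linkAction_update_of_not_mem`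
  (`S_a`, the part of `S_W` through the link `a`, does not read a link `ℓ` sharing no plaquette with
  `a`; tree `TrivializingMaps.linkAction_fibre_of_ne`); `wilsonAction_sub_linkAction_update`
  (`S_W − S_a` does not read `a`; tree `wilsonAction_sub_linkAction_fibre`).
* **`wilson_fullConditional_local`** — with `w = e^{−β S_W}` and `c(U) = w(U) / A_{{a}} w (U)` the
  exact conditional density of `U_a` given ALL other links (`A_{{a}}` the one-link `μ`-average,
  `Exactness.coordAvg μ {a}`): for every link `ℓ ≠ a` that shares NO plaquette with `a`,
  `c(U[ℓ ↦ h]) = c(U)` for all `U`, `h` — the full conditional reads only the LINK BLOCK of `a`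
  (its `≤ 2(d−1)` staples), i.e. the symbolic context of C5 at `s = ∅` is an honest upper bound
  (`S_W = S_a + (S_W − S_a)`, the second factor is blind to `a` and cancels in the ratio, the first
  is blind to `ℓ`); **`wilson_fullConditional_congr_block`** — two configurations agreeing on `a`
  and on its link block (tree `TrivializingMaps.linkBlock`) have the same full conditional at `a`
  (`eq_of_blind_off`: move the other coordinates one at a time).  No positivity, continuity or
  compactness is used.

READING (value-free): heat-bath locality, typed for the exact conditional DENSITY: before any link
is integrated, the context of a link is at most its plaquette-sharing neighbourhood (this file) and
contains its parallel plaquette-mates (`WilsonPlaquetteMateContext`, `L ≥ 3`, `β ≠ 0`, non-constant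
character); after integrating the other links at a shared site, a mate drops out
(`AutoregressiveGaugeRedundancyWilson`).  NOT CLAIMED: that every link of the block is read; any
number of ours.  Elementary over the tree; no definition is introduced; nothing is cited as a fact;
no `sorry`.
-/

noncomputable section

namespace Summit.Ventures.LatticeQCDFlow.Theory2.Autoregressive

open MeasureTheory Function
open Literature.MathematicalPhysics.QuantumFieldTheory
open Summit.Ventures.LatticeQCDFlow.Exactness Summit.Ventures.LatticeQCDFlow.TrivializingMaps

variable {d L N : ℕ} {G : Type*} [Group G]

/-! ## §1 What `S_a` and `S_W − S_a` do not read (an update is a fibre translation, tree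
`Scoring.update_eq_mulSingle_mul`) -/

variable (ρ : G →* Matrix (Fin N) (Fin N) ℂ)

/-- **`S_a` does not read a link sharing no plaquette with `a`.** [ours] -/
theorem linkAction_update_of_not_mem [NeZero L] {a ℓ : Edge d L}
    (hℓ : ∀ p : Plaquette d L, a ∈ plaqLinks p → ℓ ∉ plaqLinks p) (U : GaugeConfig d L G) (h : G) :
    linkAction ρ a (update U ℓ h) = linkAction ρ a U := by
  rw [Scoring.update_eq_mulSingle_mul, linkAction_fibre_of_ne ρ hℓ]

/-- **`S_W − S_a` does not read `a`.** [ours] -/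
theorem wilsonAction_sub_linkAction_update [NeZero L] (a : Edge d L) (U : GaugeConfig d L G) (h : G) :
    wilsonAction ρ (update U a h) - linkAction ρ a (update U a h) =
      wilsonAction ρ U - linkAction ρ a U := by
  rw [Scoring.update_eq_mulSingle_mul, wilsonAction_sub_linkAction_fibre]

/-! ## §2 The full conditional of a link reads only its link block -/

variable [MeasurableSpace G] (μ : Measure G)

omit [Group G] in
/-- The one-link average of a function blind to `ℓ ≠ a` is blind to `ℓ`. [ours] -/
theorem coordAvg_singleton_update_of_blind [NeZero L] {a ℓ : Edge d L} (hℓa : ℓ ≠ a)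
    {g : GaugeConfig d L G → ℝ} (hg : ∀ U h, g (update U ℓ h) = g U) (U : GaugeConfig d L G) (h : G) :
    coordAvg μ {a} g (update U ℓ h) = coordAvg μ {a} g U := by
  unfold coordAvg
  simp only [Finset.piecewise_singleton]
  congr 1
  funext V
  rw [update_comm hℓa, hg]

omit [Group G] in
/-- A factor blind to `a` comes out of the one-link average at `a`. [ours] -/
theorem coordAvg_singleton_mul_of_blind [NeZero L] (a : Edge d L) {f g : GaugeConfig d L G → ℝ}
    (hf : ∀ U h, f (update U a h) = f U) (U : GaugeConfig d L G) :
    coordAvg μ {a} (fun U => f U * g U) U = f U * coordAvg μ {a} g U :=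
  coordAvg_mul_left μ {a} (fun ω ω' => by rw [Finset.piecewise_singleton, hf]) U

/-- **THE FULL CONDITIONAL OF A LINK READS ONLY ITS STAPLES.**  Every group `G`, representation `ρ`,
real `β`, reference measure `μ` on `G`, every `d`, `L`: with `w = e^{−β S_W}` and the exact
conditional density `c(U) = w(U) / A_{{a}} w(U)` of `U_a` given all other links, every link `ℓ ≠ a`
that shares no plaquette with `a` satisfies `c(U[ℓ ↦ h]) = c(U)` for all `U`, `h`. [ours] -/
theorem wilson_fullConditional_local [NeZero L] (β : ℝ) {a ℓ : Edge d L} (hℓa : ℓ ≠ a)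
    (hℓ : ∀ p : Plaquette d L, a ∈ plaqLinks p → ℓ ∉ plaqLinks p) (U : GaugeConfig d L G) (h : G) :
    let w : GaugeConfig d L G → ℝ := fun U => Real.exp (-β * wilsonAction ρ U)
    w (update U ℓ h) / coordAvg μ {a} w (update U ℓ h) = w U / coordAvg μ {a} w U := by
  intro w
  -- factorisation `w = f · g`, `f` blind to `a`, `g` blind to `ℓ`
  set f : GaugeConfig d L G → ℝ := fun U => Real.exp (-β * (wilsonAction ρ U - linkAction ρ a U))
    with hfdef
  set g : GaugeConfig d L G → ℝ := fun U => Real.exp (-β * linkAction ρ a U) with hgdef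
  have hw : w = fun U => f U * g U := by
    funext V
    simp only [w, hfdef, hgdef, ← Real.exp_add]
    congr 1; ring
  have hf : ∀ V k, f (update V a k) = f V := by
    intro V k; simp only [hfdef, wilsonAction_sub_linkAction_update]
  have hg : ∀ V k, g (update V ℓ k) = g V := by
    intro V k; simp only [hgdef, linkAction_update_of_not_mem ρ hℓ]
  have hratio : ∀ V, w V / coordAvg μ {a} w V = g V / coordAvg μ {a} g V := by
    intro V
    rw [hw, coordAvg_singleton_mul_of_blind μ a hf V]
    simp only
    have hf0 : f V ≠ 0 := by rw [hfdef]; exact Real.exp_ne_zero _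
    rw [mul_comm (f V) (g V), mul_comm (f V) (coordAvg μ {a} g V)]
    exact mul_div_mul_right _ _ hf0
  rw [hratio, hratio, hg, coordAvg_singleton_update_of_blind μ hℓa hg]

omit [Group G] [MeasurableSpace G] in
/-- A function that does not read any coordinate outside `B` takes the same value on configurations
agreeing on `B` (move the coordinates one at a time). [ours] -/
theorem eq_of_blind_off [NeZero L] {c : GaugeConfig d L G → ℝ} {B : Finset (Edge d L)}
    (hc : ∀ ℓ, ℓ ∉ B → ∀ U h, c (update U ℓ h) = c U) {U U' : GaugeConfig d L G}
    (hUU' : ∀ e ∈ B, U e = U' e) : c U = c U' := by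
  classical
  -- `c U = c (s.piecewise U' U)` for every `s`, by induction on `s`
  have key : ∀ s : Finset (Edge d L), c (s.piecewise U' U) = c U := by
    intro s
    induction s using Finset.induction_on with
    | empty => simp
    | @insert e s hes ih =>
      rw [Finset.piecewise_insert]
      by_cases heB : e ∈ B
      · have : update (s.piecewise U' U) e (U' e) = s.piecewise U' U := by
          rw [← hUU' e heB]
          exact update_eq_self_iff.2 (by rw [Finset.piecewise_eq_of_notMem _ _ _ hes])
        rw [this, ih]
      · rw [hc e heB, ih]
  have h := key Finset.univ
  rw [Finset.piecewise_univ] at h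
  exact h.symm

/-- **THE FULL CONDITIONAL OF A LINK IS A FUNCTION OF THE LINK AND ITS BLOCK ONLY**: two
configurations that agree on `a` and on the link block of `a` (the links of the plaquettes through
`a`, tree `TrivializingMaps.linkBlock`) have the same exact conditional density `w / A_{{a}} w` at `a`
— every group, `ρ`, real `β`, reference measure `μ`. [ours] -/
theorem wilson_fullConditional_congr_block [NeZero L] (β : ℝ) (a : Edge d L)
    {U U' : GaugeConfig d L G} (hUU' : ∀ e, e = a ∨ e ∈ linkBlock a → U e = U' e) :
    let w : GaugeConfig d L G → ℝ := fun U => Real.exp (-β * wilsonAction ρ U)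
    w U / coordAvg μ {a} w U = w U' / coordAvg μ {a} w U' := by
  classical
  intro w
  refine eq_of_blind_off (c := fun U => w U / coordAvg μ {a} w U) (B := insert a (linkBlock a))
    (fun ℓ hℓ V h => ?_) (fun e he => hUU' e (by simpa [Finset.mem_insert] using he))
  have hℓa : ℓ ≠ a := fun h => hℓ (h ▸ Finset.mem_insert_self _ _)
  have hℓ' : ∀ p : Plaquette d L, a ∈ plaqLinks p → ℓ ∉ plaqLinks p := by
    intro p hap hℓp
    exact hℓ (Finset.mem_insert_of_mem (Finset.mem_biUnion.2 ⟨p, (mem_plaqThrough_iff a p).2 hap, hℓp⟩))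
  exact wilson_fullConditional_local ρ μ β hℓa hℓ' V h

end Summit.Ventures.LatticeQCDFlow.Theory2.Autoregressive

end
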